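import Literature.NumberTheory.LFunctions.Nicolas2012Sharp
import Literature.NumberTheory.LFunctions.TrivialZerosSimple
import Literature.NumberTheory.LFunctions.NicolasCriterion
import HarnessLib

/-!
# RH-CONDITIONAL — Nicolas 2012, Prop. 2.1 upper half: `log f(x) < 0` under RH for `x ≥ 599²`, i.e. Nicolas's inequality at the large primorials

RH-CONDITIONAL (every principal statement has the hypothesis `RiemannHypothesis`; the two lemmas
`lemma21_upper` and `re_remainder_bracket_ge` are RH-FREE); nothing here bears on the truth of RH.
Literature-typing tranche 1, discharge of the `⟹` half of **Nicolas's criterion** `nicolas_iff`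
(`NicolasCriterion.lean`; Nicolas 1983, Thm. 2 (a); Broughan, *Equivalents of RH* vol. 1, §5.6
"Nicolas' first theorem"): under RH, `N_k/φ(N_k) > e^γ log log N_k` for every primorial `N_k`.
This file proves the ANALYTIC range; the finite range `p < 599²` is a kernel computation
(`NicolasChainCheck.lean`, `NicolasChainRun.lean`) and the assembly is `NicolasCriterionProofs.lean`.

With `f(x) = e^γ log θ(x) ∏_{p ≤ x}(1 − 1/p)` (tree: `nicolasF`; Nicolas 2012, (1.9)), Nicolas's
inequality at `N = p#` is `f(p) < 1` (`Nicolas.nicolasF_natCast_eq`). Nicolas 2012 proves, under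
RH, the two-sided Prop. 2.1; the tree already holds the LOWER bound (2.18)
(`Nicolas2012_logf_lower_sharp_holds`, `Lemma24RH.logf_lowerRH`), which is what Robin's theorem
needs. Here we follow the printed route to the UPPER bound (2.19),
"`log f(x) ≤ −(W(x)+2)/(√x log x) + (2+β)/(√x log² x) + 4β/(√x log³ x) + 1/(2(x−1))`",
assembled — exactly as Nicolas says ("by collecting the information from (2.1), (2.11), (2.13),
(2.14), (2.15), (2.4)") — from:

* **Lemma 2.1, upper half** (`lemma21_upper`, RH-free): `log f(x) ≤ K(x) + 4/x` for `x ≥ 3`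
  (printed: `K(x) + 1/(2(x−1))`, `x ≥ 121`; the tree's tail bound `u(∞) − u(x) ≤ 4/x` for the
  Mertens defect, `Nicolas.mertensDefect_sub_le`, replaces `1/(2(x−1))`, and the concavity step
  `log log θ ≤ log log x + (θ − x)/(x log x)` is exact), with `K = NicolasK.nicolasKInt`;
* **Lemma 2.5, upper half** (`nicolasJ_le_of_RH`): under RH, `J(x) ≤ β/(√x log x) + β D_x` for
  `x ≥ 2`, `D_x = (1 + 4/log x)/(√x log² x)` — the mirror image of the tree's `nicolasJ_ge_of_RH`
  (`|W| ≤ β`, `|J₂| ≤ β D_x`), the sign of `J₁` now requiring the LOWER bound of the trivial-zero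
  bracket (`re_remainder_bracket_ge`, from `TrivialZerosSimple.re_psiOneRemainder_sub_mem`: the total
  increase of `Re E` after `x` is `≤ x/(2(x²−1))`), absorbed by the linear term `−log(2π)/(x log x)`;
* **Cor. 2.1, lower half, weakened** (`jk_lower_of_RH`): under RH, for `x ≥ 599² = 358801`,
  `J(x) − K(x) ≥ (4/5) F_{1/2}(x)` (printed: `F_{1/2} ≤ J − K` for `x ≥ 121` from the pointwise
  `ψ − θ ≥ √x`, (2.11), whose range `121 ≤ x < 599³` is a table; here `ψ(t) − θ(t) ≥ θ(√t) ≥ (4/5)√t`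
  for `√t ≥ 599` by Schoenfeld's bound under RH, `Nicolas2012Sharp.theta_ge_four_fifths`, so no
  table is needed, at the price of the range; Schoenfeld's (6.3) enters as the hypothesis
  `(hS : Schoenfeld1976_theta)`, discharged in the tree by `Schoenfeld1976_theta_holds`, so that every
  theorem here has standard axioms);
* (2.4) lower: `F_{1/2}(x) ≥ 2/(√x log x) − 2/(√x log² x)` (`NicolasFz.Fhalf_ge`), `β < 0.0552`
  (`nicolasBeta_lt`).

Hence **`log_nicolasF_neg_of_RH`**: under RH, `log f(x) < 0` for `x ≥ 358801`, and
**`nicolasInequality_primorial_of_RH_of_le`**: under RH, `e^γ log log(p#) < p#/φ(p#)` for every prime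
`p ≥ 358801` (Nicolas 1983, Thm. 2 (a), large range; Nicolas's own threshold for the analytic
argument is `x₀ = 10⁹` in 2012 with a computation below).

## References

* J.-L. Nicolas, *Small values of the Euler function and the Riemann hypothesis*, Acta Arith. 155
  (2012), 311–321 (arXiv:1202.0729): Lemma 2.1 (2.1), Cor. 2.1 (2.13), Lemma 2.5 (2.14)–(2.15),
  Prop. 2.1 (2.16) and the displays (2.18)–(2.19) of its proof [corpus:paper:arxiv-1202.0729 p0004–p0005].
  [Nicolas2012]
* J.-L. Nicolas, *Petites valeurs de la fonction d'Euler*, J. Number Theory 17 (1983), 375–388,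
  Thm. 2 (a). [Nicolas1983]
* K. Broughan, *Equivalents of the Riemann Hypothesis. Vol. 1*, CUP 2017, §5.6 "Nicolas' First
  Theorem" (pp. 135–137). [Broughan2017Arithmetic]
-/

noncomputable section

open Filter Set MeasureTheory Topology
open scoped Real Chebyshev

namespace Literature.NumberTheory.LFunctions

namespace NicolasUpper

open Nicolas Mertens NicolasJ NicolasFz NicolasK NicolasJExplicit

/-! ### Lemma 2.1, upper half (RH-free) -/

/-- The Mertens defect is within `4/x` of its limit: `γ − B₁ − 4/x ≤ u(x)` for `x ≥ 1`
(`u(x) = ∑_{p ≤ x}(−log(1−1/p) − 1/p)`, `u(∞) = γ − B₁`). [cite: Nicolas1983, §2, (11)] -/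
theorem limit_sub_le_mertensDefect {x : ℝ} (hx : 1 ≤ x) :
    Real.eulerMascheroniConstant - meisselMertens - 4 / x ≤ mertensDefect x := by
  have ht : Tendsto (fun y ↦ mertensDefect y) atTop
      (𝓝 (Real.eulerMascheroniConstant - meisselMertens)) := by
    have h := tendsto_mertensLog_sub_primeRecipSum
    rw [NicolasK.tsum_primeLogCoeffSubInv_eq] at h
    exact h
  have hev : ∀ᶠ y in atTop, mertensDefect y ≤ mertensDefect x + 4 / x := by
    filter_upwards [eventually_ge_atTop x] with y hy
    linarith [mertensDefect_sub_le hx hy]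
  linarith [le_of_tendsto ht hev]

/-- Concavity step: `log log θ ≤ log log x + (θ − x)/(x log x)` whenever `θ > 1`, `x > 1`
(`log y ≤ y − 1` twice). [cite: Nicolas2012, Lemma 2.1 (proof)] -/
theorem loglog_le_loglog_add {x θ₀ : ℝ} (hx : 1 < x) (hθ : 1 < θ₀) :
    Real.log (Real.log θ₀) ≤ Real.log (Real.log x) + (θ₀ - x) / (x * Real.log x) := by
  have hx0 : 0 < x := by linarith
  have hlx : 0 < Real.log x := Real.log_pos hx
  have hlθ : 0 < Real.log θ₀ := Real.log_pos hθ
  have h1 : Real.log (Real.log θ₀) - Real.log (Real.log x) ≤ Real.log θ₀ / Real.log x - 1 := by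
    rw [← Real.log_div hlθ.ne' hlx.ne']
    exact Real.log_le_sub_one_of_pos (div_pos hlθ hlx)
  have h2 : Real.log θ₀ - Real.log x ≤ θ₀ / x - 1 := by
    rw [← Real.log_div (by linarith) hx0.ne']
    exact Real.log_le_sub_one_of_pos (div_pos (by linarith) hx0)
  have h3 : Real.log θ₀ / Real.log x - 1 = (Real.log θ₀ - Real.log x) / Real.log x := by
    field_simp
  have h4 : (Real.log θ₀ - Real.log x) / Real.log x ≤ (θ₀ / x - 1) / Real.log x :=
    div_le_div_of_nonneg_right h2 hlx.le
  have h5 : (θ₀ / x - 1) / Real.log x = (θ₀ - x) / (x * Real.log x) := by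
    field_simp
  linarith [h1, h3 ▸ h4, h5]

/-- **Nicolas 2012, Lemma 2.1 (2.1), upper half (tree form, RH-free)**: for `x ≥ 3`,
`log f(x) ≤ K(x) + 4/x`, where `K = NicolasK.nicolasKInt` is Nicolas's `K(x)` ((1.15)) and the
printed `1/(2(x−1))` is replaced by the tree's tail bound `4/x`. Proof: `log f = γ + log log θ(x) − A(x)`,
`A = P + u ≥ P + γ − B₁ − 4/x`, `log log θ ≤ log log x + (θ−x)/(x log x)`.
[cite: Nicolas2012, Lemma 2.1 (2.1); Nicolas1983, Prop. 1] -/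
theorem lemma21_upper {x : ℝ} (hx : 3 ≤ x) :
    Real.log (nicolasF x) ≤ nicolasKInt x + 4 / x := by
  have hx1 : 1 < x := by linarith
  rw [log_nicolasF_eq hx, nicolasKInt_eq]
  have hθ : 1 < θ x := one_lt_theta hx
  have h1 := loglog_le_loglog_add hx1 hθ
  have h2 := limit_sub_le_mertensDefect hx1.le
  rw [mertensDefect] at h2
  linarith

/-! ### Lemma 2.5, upper half: `J(x) ≤ β/(√x log x) + β D_x` under RH -/

/-- **Real part of the zeros' bracket, upper half** (mirror of `re_zeros_bracket_ge`): under RH,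
for `x > 1`, `Re(−∑_ρ (m(ρ)/ρ) F_ρ(x)) ≤ β/(√x log x) + β D_x` (`|W| ≤ β`, (1.19); `|J₂| ≤ β D_x`,
(2.15)). [cite: Nicolas2012, Lemma 2.5 (2.14)–(2.15)] -/
theorem re_zeros_bracket_le (hRH : RiemannHypothesis) {x : ℝ} (hx : 1 < x) :
    (-∑' ρ : Zeros, (riemannZetaZeroOrder (ρ : ℂ) : ℂ) / (ρ : ℂ) * Fz (ρ : ℂ) x).re ≤
      nicolasBeta / (Real.sqrt x * Real.log x) + nicolasBeta * Dx x := by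
  have hx0 : 0 < x := by linarith
  have hlx : 0 < Real.log x := Real.log_pos hx
  have hsx : 0 < Real.sqrt x := Real.sqrt_pos.2 hx0
  have hD := Dx_pos hx
  set c₁ : ℂ → ℂ := fun ρ ↦ (x : ℂ) ^ (ρ - 1) * (Real.sqrt x : ℂ) with hc₁
  set c₂ : ℂ → ℂ := fun ρ ↦ (1 - ρ) * rz ρ x / (Dx x : ℂ) with hc₂
  have hc₁le : ∀ ρ ∈ RHWave0.riemannZetaNontrivialZeros, ‖c₁ ρ‖ ≤ 1 := by
    intro ρ hρ
    have hre := re_eq_half_of_RH hRH hρ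
    rw [hc₁]
    simp only
    rw [norm_mul, Complex.norm_cpow_eq_rpow_re_of_pos hx0, Complex.sub_re, Complex.one_re, hre,
      Complex.norm_real, Real.norm_eq_abs, abs_of_pos hsx, Real.sqrt_eq_rpow, ← Real.rpow_add hx0]
    norm_num
  have hc₂le : ∀ ρ ∈ RHWave0.riemannZetaNontrivialZeros, ‖c₂ ρ‖ ≤ 1 := by
    intro ρ hρ
    have hre := re_eq_half_of_RH hRH hρ
    have h1ρ : 1 - ρ ≠ 0 := one_sub_ne_zero' hρ
    have hn : 0 < ‖1 - ρ‖ := norm_pos_iff.2 h1ρ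
    have hr := norm_rz_le hre hx
    rw [hc₂]
    simp only
    rw [norm_div, norm_mul, Complex.norm_real, Real.norm_eq_abs, abs_of_pos hD, div_le_one hD]
    calc ‖1 - ρ‖ * ‖rz ρ x‖ ≤ ‖1 - ρ‖ * ((1 + 4 / Real.log x) / (‖1 - ρ‖ * Real.sqrt x * Real.log x ^ 2)) :=
          mul_le_mul_of_nonneg_left hr hn.le
      _ = Dx x := by rw [Dx]; field_simp
  obtain ⟨hsum₁, hle₁⟩ := norm_tsum_zeroOrder_mul_div_le_nicolasBeta hRH hc₁le
  obtain ⟨hsum₂, hle₂⟩ := norm_tsum_zeroOrder_mul_div_le_nicolasBeta hRH hc₂le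
  set T₁ : Zeros → ℂ := fun ρ ↦ (riemannZetaZeroOrder (ρ : ℂ) : ℂ) * c₁ ρ / ((ρ : ℂ) * (1 - ρ)) with hT₁
  set T₂ : Zeros → ℂ := fun ρ ↦ (riemannZetaZeroOrder (ρ : ℂ) : ℂ) * c₂ ρ / ((ρ : ℂ) * (1 - ρ)) with hT₂
  set a : ℝ := 1 / (Real.sqrt x * Real.log x) with ha
  have hterm : ∀ ρ : Zeros, -((riemannZetaZeroOrder (ρ : ℂ) : ℂ) / (ρ : ℂ) * Fz (ρ : ℂ) x) =
      -(a : ℂ) * T₁ ρ - (Dx x : ℂ) * T₂ ρ := by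
    intro ρ
    have hρ0 : (ρ : ℂ) ≠ 0 := ne_zero ρ.2
    have h1ρ : 1 - (ρ : ℂ) ≠ 0 := one_sub_ne_zero' ρ.2
    have hDC : (Dx x : ℂ) ≠ 0 := by exact_mod_cast hD.ne'
    have hsC : (Real.sqrt x : ℂ) ≠ 0 := by exact_mod_cast hsx.ne'
    have hlC : (Real.log x : ℂ) ≠ 0 := by exact_mod_cast hlx.ne'
    rw [Fz_eq (re_lt_one ρ.2) hx, hT₁, hT₂, hc₁, hc₂, ha]
    simp only
    push_cast
    field_simp
    ring
  have hs₁ : Summable T₁ := hsum₁.of_norm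
  have hs₂ : Summable T₂ := hsum₂.of_norm
  have htsum : -∑' ρ : Zeros, (riemannZetaZeroOrder (ρ : ℂ) : ℂ) / (ρ : ℂ) * Fz (ρ : ℂ) x =
      -(a : ℂ) * ∑' ρ, T₁ ρ - (Dx x : ℂ) * ∑' ρ, T₂ ρ := by
    rw [← tsum_neg, tsum_congr hterm, ← tsum_mul_left, ← tsum_mul_left,
      ← (hs₁.mul_left _).tsum_sub (hs₂.mul_left _)]
  rw [htsum, Complex.sub_re, Complex.mul_re, Complex.mul_re]
  simp only [Complex.neg_re, Complex.ofReal_re, Complex.neg_im, Complex.ofReal_im, neg_zero,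
    zero_mul, sub_zero]
  have ha0 : 0 ≤ a := by rw [ha]; positivity
  have h1' : -nicolasBeta ≤ (∑' ρ, T₁ ρ).re := by
    have := (Complex.abs_re_le_norm (∑' ρ, T₁ ρ)).trans hle₁
    exact (abs_le.1 this).1
  have h2' : -nicolasBeta ≤ (∑' ρ, T₂ ρ).re := by
    have := (Complex.abs_re_le_norm (∑' ρ, T₂ ρ)).trans hle₂
    exact (abs_le.1 this).1
  have e : nicolasBeta / (Real.sqrt x * Real.log x) = a * nicolasBeta := by rw [ha]; ring
  rw [e]
  nlinarith [mul_le_mul_of_nonneg_left h1' ha0, mul_le_mul_of_nonneg_left h2' hD.le]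

/-- **The trivial zeros' bracket, lower half** (RH-free): for `x > 1`,
`Re(E(x) w₀(x) + ∫_x^∞ E w₀') ≥ −(x/(2(x²−1))) w₀(x)`, since `Re E` is non-decreasing with total
increase after `x` at most `x/(2(x²−1))` (`TrivialZerosSimple.re_psiOneRemainder_sub_mem`) and
`w₀' < 0`, `∫_x^∞ w₀' = −w₀(x)`. (Nicolas: `0 < J₁`.) [cite: Nicolas2012, Lemma 2.5 (the term `J₁`)] -/
theorem re_remainder_bracket_ge {x C : ℝ} (hx : 1 < x)
    (hC : ∀ t : ℝ, 0 < t → ‖psiOneRemainder t‖ ≤ C * Real.sqrt t) :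
    -(x / (2 * (x ^ 2 - 1))) * w0 x ≤
      (psiOneRemainder x * (w0 x : ℂ) + ∫ t in Ioi x, psiOneRemainder t * (w0' t : ℂ)).re := by
  have hint := integrableOn_psiOneRemainder_mul_w0' hx hC
  obtain ⟨hint', hval⟩ := integral_w0' hx
  rw [Complex.add_re, Complex.mul_re, Complex.ofReal_re, Complex.ofReal_im, mul_zero, sub_zero]
  have hre : (∫ t in Ioi x, psiOneRemainder t * (w0' t : ℂ)).re =
      ∫ t in Ioi x, (psiOneRemainder t).re * w0' t := by
    have h := integral_re hint
    simp only [RCLike.re_to_complex, Complex.mul_re, Complex.ofReal_re, Complex.ofReal_im, mul_zero,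
      sub_zero] at h
    exact h.symm
  rw [hre]
  set δ : ℝ := x / (2 * (x ^ 2 - 1)) with hδ
  have hmono : ∫ t in Ioi x, ((psiOneRemainder x).re + δ) * w0' t ≤
      ∫ t in Ioi x, (psiOneRemainder t).re * w0' t := by
    refine setIntegral_mono_on (hint'.const_mul _) ?_ measurableSet_Ioi fun t ht ↦ ?_
    · have h0 : Integrable (fun t : ℝ ↦ (psiOneRemainder t).re * w0' t) (volume.restrict (Ioi x)) := by
        simpa [RCLike.re_to_complex] using hint.re
      exact h0
    · have h1 := (re_psiOneRemainder_sub_mem hx (le_of_lt ht)).2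
      have h2 := (w0'_neg (hx.trans ht)).le
      rw [← hδ] at h1
      nlinarith
  rw [MeasureTheory.integral_const_mul, hval] at hmono
  nlinarith [hmono]

/-- `log(2π) ≥ 1` (`2π > e`). [folklore] -/
private theorem one_le_log_two_pi : 1 ≤ Real.log (2 * π) := by
  rw [Real.le_log_iff_exp_le (by positivity)]
  have h1 := Real.exp_one_lt_d9
  have h2 := Real.pi_gt_three
  linarith

/-- **Nicolas 2012, Lemma 2.5, upper half in `W`-free form**: under RH, for `x ≥ 2`,
`J(x) ≤ β/(√x log x) + β (1 + 4/log x)/(√x log² x)` ((2.14)–(2.15) with `|W(x)| ≤ β`, (1.19), and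
`J₁ > 0`; the small negative of the trivial zeros' bracket is absorbed by `−log(2π)/(x log x)`).
[cite: Nicolas2012, Lemma 2.5 (2.14)–(2.15)] -/
theorem nicolasJ_le_of_RH (hRH : RiemannHypothesis) {x : ℝ} (hx : 2 ≤ x) :
    nicolasJ x ≤ nicolasBeta / (Real.sqrt x * Real.log x)
      + nicolasBeta * ((1 + 4 / Real.log x) / (Real.sqrt x * Real.log x ^ 2)) := by
  have hx1 : 1 < x := by linarith
  have hx0 : 0 < x := by linarith
  obtain ⟨C, -, hC⟩ := exists_norm_psiOneRemainder_le
  have hiZ := integrableOn_Zsum_mul_w0' hRH hx1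
  obtain ⟨hiLr, hL⟩ := linear_term hx1
  have hiL : IntegrableOn (fun t : ℝ ↦ (t : ℂ) * (w0' t : ℂ)) (Ioi x) := by
    have h0 : IntegrableOn (fun t : ℝ ↦ ((t * w0' t : ℝ) : ℂ)) (Ioi x) := hiLr.ofReal (𝕜 := ℂ)
    refine h0.congr_fun (fun t _ ↦ by push_cast; ring) measurableSet_Ioi
  have hiE := integrableOn_psiOneRemainder_mul_w0' hx1 hC
  obtain ⟨-, hZ⟩ := zeros_bracket hRH hx1
  have hZre := re_zeros_bracket_le hRH hx1
  have hE := re_remainder_bracket_ge hx1 hC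
  have hJ : (nicolasJ x : ℂ) = -(Rone x : ℂ) * (w0 x : ℂ) - ∫ t in Ioi x, (Rone t : ℂ) * (w0' t : ℂ) := by
    rw [nicolasJ]
    push_cast
    rw [← integral_complex_ofReal]
    congr 1
    refine setIntegral_congr_fun measurableSet_Ioi fun t _ ↦ ?_
    push_cast; ring
  have hRx := Rone_eq_explicit hx1.le
  have hint_eq : ∫ t in Ioi x, (Rone t : ℂ) * (w0' t : ℂ) =
      -(∫ t in Ioi x, Zsum t * (w0' t : ℂ)) - Complex.log (2 * π) * (∫ t in Ioi x, (t : ℂ) * (w0' t : ℂ)) +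
        ∫ t in Ioi x, psiOneRemainder t * (w0' t : ℂ) := by
    have h1 : ∫ t in Ioi x, (Rone t : ℂ) * (w0' t : ℂ) =
        ∫ t in Ioi x, (-(Zsum t * (w0' t : ℂ)) - Complex.log (2 * π) * ((t : ℂ) * (w0' t : ℂ)) +
          psiOneRemainder t * (w0' t : ℂ)) := by
      refine setIntegral_congr_fun measurableSet_Ioi fun t ht ↦ ?_
      rw [Rone_eq_explicit (hx1.trans ht).le]; ring
    have hA : IntegrableOn (fun t : ℝ ↦ -(Zsum t * (w0' t : ℂ)) - Complex.log (2 * π) * ((t : ℂ) * (w0' t : ℂ)))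
        (Ioi x) := hiZ.neg.sub (hiL.const_mul _)
    have hN : IntegrableOn (fun t : ℝ ↦ -(Zsum t * (w0' t : ℂ))) (Ioi x) := hiZ.neg
    have hM : IntegrableOn (fun t : ℝ ↦ Complex.log (2 * π) * ((t : ℂ) * (w0' t : ℂ))) (Ioi x) :=
      hiL.const_mul _
    rw [h1, integral_add hA hiE, integral_sub hN hM, MeasureTheory.integral_neg,
      MeasureTheory.integral_const_mul]
  have hLC : (x : ℂ) * (w0 x : ℂ) + ∫ t in Ioi x, (t : ℂ) * (w0' t : ℂ) = ((-(1 / (x * Real.log x)) : ℝ) : ℂ) := by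
    rw [← hL]
    push_cast
    rw [← integral_complex_ofReal]
    congr 1
    refine setIntegral_congr_fun measurableSet_Ioi fun t _ ↦ ?_
    push_cast; ring
  have key : (nicolasJ x : ℂ) =
      (Zsum x * (w0 x : ℂ) + ∫ t in Ioi x, Zsum t * (w0' t : ℂ)) +
        Complex.log (2 * π) * ((x : ℂ) * (w0 x : ℂ) + ∫ t in Ioi x, (t : ℂ) * (w0' t : ℂ)) -
        (psiOneRemainder x * (w0 x : ℂ) + ∫ t in Ioi x, psiOneRemainder t * (w0' t : ℂ)) := by
    rw [hJ, hint_eq, hRx]; ring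
  rw [hZ, hLC, log_two_pi] at key
  have hre : nicolasJ x =
      (-∑' ρ : Zeros, (riemannZetaZeroOrder (ρ : ℂ) : ℂ) / (ρ : ℂ) * Fz (ρ : ℂ) x).re +
        Real.log (2 * π) * (-(1 / (x * Real.log x))) -
        (psiOneRemainder x * (w0 x : ℂ) + ∫ t in Ioi x, psiOneRemainder t * (w0' t : ℂ)).re := by
    have h := congrArg Complex.re key
    rw [Complex.ofReal_re, Complex.sub_re, Complex.add_re, ← Complex.ofReal_mul, Complex.ofReal_re] at h
    exact h
  rw [hre]
  -- the trivial-zero bracket is absorbed by the linear term: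
  -- `(x/(2(x²−1))) w₀(x) ≤ log(2π)/(x log x)`
  have hlx : 0 < Real.log x := Real.log_pos hx1
  have hl2 : (0.6931471803 : ℝ) < Real.log x :=
    lt_of_lt_of_le Real.log_two_gt_d9 (Real.log_le_log (by norm_num) hx)
  have habs : x / (2 * (x ^ 2 - 1)) * w0 x ≤ Real.log (2 * π) / (x * Real.log x) := by
    have h2π := one_le_log_two_pi
    have hx21 : 0 < x ^ 2 - 1 := by nlinarith
    have hinv : 1 / Real.log x ≤ 3 / 2 := by
      rw [div_le_div_iff₀ hlx (by norm_num)]; linarith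
    have hw0le : w0 x ≤ 4 / x ^ 2 := by
      rw [w0, NicolasFz.wt]
      refine div_le_div_of_nonneg_right ?_ (by positivity)
      have hsq : 1 / Real.log x ^ 2 = (1 / Real.log x) ^ 2 := by rw [one_div_pow]
      rw [hsq]
      nlinarith [hinv, one_div_pos.2 hlx]
    have step1 : x / (2 * (x ^ 2 - 1)) * w0 x ≤ x / (2 * (x ^ 2 - 1)) * (4 / x ^ 2) :=
      mul_le_mul_of_nonneg_left hw0le (by positivity)
    have step2 : x / (2 * (x ^ 2 - 1)) * (4 / x ^ 2) = 2 / (x * (x ^ 2 - 1)) := by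
      field_simp; ring
    have step3 : 2 / (x * (x ^ 2 - 1)) ≤ 1 / (x * Real.log x) := by
      rw [div_le_div_iff₀ (by positivity) (by positivity)]
      have hlog := Real.log_le_sub_one_of_pos hx0
      nlinarith
    have step4 : 1 / (x * Real.log x) ≤ Real.log (2 * π) / (x * Real.log x) :=
      div_le_div_of_nonneg_right h2π (by positivity)
    linarith
  have e : Real.log (2 * π) * (-(1 / (x * Real.log x))) = -(Real.log (2 * π) / (x * Real.log x)) := by
    ring
  rw [e]
  rw [Dx] at hZre
  linarith [hZre, hE, habs]

/-! ### Cor. 2.1, lower half (weakened range): `J − K ≥ (4/5) F_{1/2}` under RH for `x ≥ 599²` -/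

/-- Under RH, for `t ≥ 599² = 358801`: `ψ(t) − θ(t) ≥ θ(√t) ≥ (4/5) √t` (`ψ − θ = ∑_{k≥2} θ(t^{1/k})`,
Mathlib; Schoenfeld's bound at `√t ≥ 599`, `Nicolas2012Sharp.theta_ge_four_fifths`).
[cite: Nicolas2012, Lemma 2.4 (2.9)–(2.11) (weakened); Schoenfeld1976, Thm. 10 (6.3)] -/
theorem psi_sub_theta_ge_of_RH (hS : Schoenfeld1976_theta) (hRH : RiemannHypothesis) {t : ℝ}
    (ht : 358801 ≤ t) : 4 / 5 * Real.sqrt t ≤ ψ t - θ t := by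
  have ht2 : (2 : ℝ) ≤ t := by linarith
  have ht0 : 0 ≤ t := by linarith
  have hsq : (599 : ℝ) ≤ Real.sqrt t := by
    rw [show (599 : ℝ) = Real.sqrt (599 ^ 2) by rw [Real.sqrt_sq (by norm_num)]]
    exact Real.sqrt_le_sqrt (by norm_num; linarith)
  have hθ := Nicolas2012Sharp.theta_ge_four_fifths hS hRH hsq
  rw [Chebyshev.psi_eq_theta_add_sum_theta ht2, add_sub_cancel_left]
  have hK : 2 ∈ Finset.Icc 2 ⌊Real.log t / Real.log 2⌋₊ := by
    rw [Finset.mem_Icc]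
    refine ⟨le_rfl, Nat.le_floor ?_⟩
    rw [Nat.cast_ofNat, le_div_iff₀ (Real.log_pos one_lt_two)]
    calc (2 : ℝ) * Real.log 2 = Real.log (2 ^ 2) := by rw [Real.log_pow]; norm_num
      _ ≤ Real.log t := Real.log_le_log (by norm_num) (by norm_num; linarith)
  have hle : θ (t ^ ((1 : ℝ) / 2)) ≤ ∑ n ∈ Finset.Icc 2 ⌊Real.log t / Real.log 2⌋₊, θ (t ^ ((1 : ℝ) / n)) := by
    refine Finset.single_le_sum (f := fun n : ℕ ↦ θ (t ^ ((1 : ℝ) / n))) (fun n _ ↦ Chebyshev.theta_nonneg _) hK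
      |>.trans_eq' ?_
    norm_num
  rw [Real.sqrt_eq_rpow] at hθ ⊢
  linarith

/-- The real integrand of `F_{1/2}`: `t^{1/2−2}(1/log t + 1/log² t) = t^{1/2} w₀(t)` (`t > 0`).
[cite: Nicolas2012, (1.17)] -/
private theorem rpow_mul_w0_eq {t : ℝ} (ht : 0 < t) :
    t ^ ((1 : ℝ) / 2 - 2) * wt t = t ^ ((1 : ℝ) / 2) * w0 t := by
  rw [Real.rpow_sub ht, Real.rpow_two, w0]
  ring

/-- `∫_x^X t^{1/2} w₀(t) dt → F_{1/2}(x)` as `X → ∞` (`x > 1`). [cite: Nicolas2012, (1.17)] -/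
theorem tendsto_integral_rpow_mul_w0 {x : ℝ} (hx : 1 < x) :
    Tendsto (fun X : ℝ ↦ ∫ t in x..X, t ^ ((1 : ℝ) / 2) * w0 t) atTop
      (𝓝 ((Fz (1 / 2 : ℝ) x).re)) := by
  have hx0 : 0 < x := by linarith
  have hintC := integrableOn_Fz (z := ((1 / 2 : ℝ) : ℂ)) (x := x) (by simp; norm_num) hx
  have hintR : IntegrableOn (fun t : ℝ ↦ t ^ ((1 : ℝ) / 2 - 2) * wt t) (Ioi x) := by
    have h2 : IntegrableOn (fun t : ℝ ↦ (((t ^ ((1 : ℝ) / 2 - 2) * wt t : ℝ)) : ℂ)) (Ioi x) :=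
      hintC.congr_fun (fun t ht ↦ by
        have := integrand_ofReal (a := (1 : ℝ) / 2) (hx0.trans ht)
        simpa using this) measurableSet_Ioi
    have h3 : Integrable (fun t : ℝ ↦ t ^ ((1 : ℝ) / 2 - 2) * wt t) (volume.restrict (Ioi x)) := by
      simpa using h2.re
    exact h3
  have hintR' : IntegrableOn (fun t : ℝ ↦ t ^ ((1 : ℝ) / 2) * w0 t) (Ioi x) :=
    hintR.congr_fun (fun t ht ↦ rpow_mul_w0_eq (hx0.trans ht)) measurableSet_Ioi
  have hF : (Fz (1 / 2 : ℝ) x).re = ∫ t in Ioi x, t ^ ((1 : ℝ) / 2) * w0 t := by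
    rw [Fz_ofReal hx, Complex.ofReal_re]
    rw [show ((1 / 2 : ℝ) - 2) = ((1 : ℝ) / 2 - 2) by norm_num]
    exact setIntegral_congr_fun measurableSet_Ioi fun t ht ↦ rpow_mul_w0_eq (hx0.trans ht)
  rw [hF]
  exact intervalIntegral_tendsto_integral_Ioi x hintR' tendsto_id

/-- **Nicolas 2012, Cor. 2.1 (2.13), lower half, in the weakened form `J − K ≥ (4/5) F_{1/2}`**:
under RH, for `x ≥ 599² = 358801` (printed: `F_{1/2} ≤ J − K` for `x ≥ 121`, resting on the table
(2.11) below `599³`). [cite: Nicolas2012, Cor. 2.1 (2.13)] -/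
theorem jk_lower_of_RH (hS : Schoenfeld1976_theta) (hRH : RiemannHypothesis) {x : ℝ}
    (hx : 358801 ≤ x) : 4 / 5 * (Fz (1 / 2 : ℝ) x).re ≤ nicolasJ x - nicolasKInt x := by
  have hx1 : 1 < x := by linarith
  obtain ⟨C, hC⟩ := exists_abs_Rone_le_of_RH hRH
  have hR : ∀ t, x ≤ t → |Rone t| ≤ C * t ^ (3 / 2 : ℝ) := fun t ht ↦ hC t (by linarith)
  have hlim := (tendsto_integral_R_mul_w0 hx1 hR).sub (tendsto_integral_S_mul_w0 hx1)
  have hlow := (tendsto_integral_rpow_mul_w0 hx1).const_mul (4 / 5 : ℝ)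
  refine le_of_tendsto_of_tendsto hlow hlim ?_
  filter_upwards [eventually_ge_atTop x] with X hX
  have hiψ := intervalIntegrable_R_mul_w0 hx1 hX
  have hiθ := intervalIntegrable_S_mul_w0 hx1 hX
  have hi2 := intervalIntegrable_rpow_mul_w0 (1 / 2) hx1 hX
  rw [← intervalIntegral.integral_sub hiψ hiθ, ← intervalIntegral.integral_const_mul]
  refine intervalIntegral.integral_mono_on hX (hi2.const_mul _) (hiψ.sub hiθ) fun t ht ↦ ?_
  have ht1 : 1 < t := hx1.trans_le ht.1
  have hw := (w0_pos ht1).le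
  have h := psi_sub_theta_ge_of_RH hS hRH (hx.trans ht.1)
  rw [Real.sqrt_eq_rpow] at h
  have : 4 / 5 * (t ^ ((1 : ℝ) / 2) * w0 t) = (4 / 5 * t ^ ((1 : ℝ) / 2)) * w0 t := by ring
  rw [this]
  have e2 : (ψ t - t) * w0 t - (θ t - t) * w0 t = (ψ t - θ t) * w0 t := by ring
  rw [e2]
  exact mul_le_mul_of_nonneg_right h hw

/-! ### Assembly: `log f(x) < 0` under RH for `x ≥ 599²` -/

/-- `log x ≥ 12` for `x ≥ 358801` (`e¹² < 162755`). [folklore] -/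
private theorem twelve_le_log {x : ℝ} (hx : 358801 ≤ x) : 12 ≤ Real.log x := by
  rw [Real.le_log_iff_exp_le (by linarith)]
  have h1 : Real.exp 12 = Real.exp 1 ^ 12 := by rw [← Real.exp_nat_mul]; norm_num
  rw [h1]
  have h2 := Real.exp_one_lt_d9
  have h3 : Real.exp 1 ^ 12 < 2.7182818286 ^ 12 :=
    pow_lt_pow_left₀ h2 (Real.exp_pos 1).le (by norm_num)
  have h4 : (2.7182818286 : ℝ) ^ 12 < 358801 := by norm_num
  linarith

/-- `log x ≤ √x/6` for `x ≥ 358801` (`log x ≤ 4 x^{1/4}` and `x^{1/4} ≥ 24`). [folklore] -/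
private theorem log_le_sqrt_div {x : ℝ} (hx : 358801 ≤ x) : Real.log x ≤ Real.sqrt x / 6 := by
  have hx0 : 0 < x := by linarith
  set u : ℝ := x ^ ((1 : ℝ) / 4) with hu
  have hu0 : 0 < u := Real.rpow_pos_of_pos hx0 _
  have hlog : Real.log x ≤ 4 * u := by
    have h := Real.log_le_rpow_div hx0.le (show (0 : ℝ) < 1 / 4 by norm_num)
    rw [← hu] at h
    linarith [show u / (1 / 4 : ℝ) = 4 * u by ring]
  have husq : u * u = Real.sqrt x := by
    rw [hu, ← Real.rpow_add hx0, Real.sqrt_eq_rpow]; norm_num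
  have hu24 : 24 ≤ u := by
    have h24 : (24 : ℝ) = ((24 : ℝ) ^ (4 : ℕ)) ^ ((1 : ℝ) / 4) := by
      rw [← Real.rpow_natCast, ← Real.rpow_mul (by norm_num)]; norm_num
    rw [h24, hu]
    exact Real.rpow_le_rpow (by norm_num) (by norm_num; linarith) (by norm_num)
  nlinarith

/-- **Nicolas 2012, Prop. 2.1 (2.16)/(2.19), qualitative upper half (PROVED under RH)**: under the
Riemann hypothesis, `log f(x) < 0` — i.e. `∏_{p ≤ x}(1 − 1/p)⁻¹ > e^γ log θ(x)` — for every
`x ≥ 599² = 358801`. Explicitly `log f(x) ≤ (β − 8/5 + 2/3)/(√x log x) + (β(1+4/log x) + 8/5)/(√x log² x) < 0`.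
[cite: Nicolas2012, Prop. 2.1 (2.16) and (2.19); Nicolas1983, Thm. 2 (a)] -/
theorem log_nicolasF_neg_of_RH (hS : Schoenfeld1976_theta) (hRH : RiemannHypothesis) {x : ℝ}
    (hx : 358801 ≤ x) : Real.log (nicolasF x) < 0 := by
  have hx1 : 1 < x := by linarith
  have hx0 : 0 < x := by linarith
  have h1 := lemma21_upper (show (3 : ℝ) ≤ x by linarith)
  have h2 := jk_lower_of_RH hS hRH hx
  have h3 := nicolasJ_le_of_RH hRH (show (2 : ℝ) ≤ x by linarith)
  have h4 := Fhalf_ge hx1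
  have hβ := nicolasBeta_lt
  have hβ0 : 0 < nicolasBeta := lt_trans (by norm_num) nicolasBeta_gt
  have hL := twelve_le_log hx
  have hLs := log_le_sqrt_div hx
  set L := Real.log x with hLdef
  set s := Real.sqrt x with hsdef
  have hs0 : 0 < s := Real.sqrt_pos.2 hx0
  have hL0 : 0 < L := by linarith
  have hxs : x = s * s := (Real.mul_self_sqrt hx0.le).symm
  -- the budget, in units of `A = 1/(s L)`
  set A := 1 / (s * L) with hA
  have hA0 : 0 < A := by rw [hA]; positivity
  have e1 : nicolasBeta / (s * L) = nicolasBeta * A := by rw [hA]; ring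
  have e2 : (1 + 4 / L) / (s * L ^ 2) = A * ((1 + 4 / L) / L) := by rw [hA]; field_simp
  have e3 : 2 / (s * L) = 2 * A := by rw [hA]; ring
  have e4 : 2 / (s * L ^ 2) = 2 * A / L := by rw [hA]; field_simp
  have h5 : 4 / x ≤ 2 / 3 * A := by
    rw [hxs, hA, show (2 : ℝ) / 3 * (1 / (s * L)) = 2 / (3 * (s * L)) by ring,
      div_le_div_iff₀ (by positivity) (by positivity)]
    nlinarith [hLs, hs0, hL0]
  have h6 : (1 + 4 / L) / L ≤ (1 + 4 / 12) / 12 := by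
    have ha : 1 + 4 / L ≤ 1 + 4 / 12 := by
      have := div_le_div_of_nonneg_left (show (0 : ℝ) ≤ 4 by norm_num) (by norm_num) hL
      linarith
    calc (1 + 4 / L) / L ≤ (1 + 4 / 12) / L := div_le_div_of_nonneg_right ha hL0.le
      _ ≤ (1 + 4 / 12) / 12 := div_le_div_of_nonneg_left (by norm_num) (by norm_num) hL
  have h7 : 2 * A / L ≤ 2 * A / 12 := div_le_div_of_nonneg_left (by positivity) (by norm_num) hL
  rw [e1, e2] at h3
  rw [e3, e4] at h4
  have h8 : nicolasBeta * (A * ((1 + 4 / L) / L)) ≤ nicolasBeta * (A * ((1 + 4 / 12) / 12)) :=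
    mul_le_mul_of_nonneg_left (mul_le_mul_of_nonneg_left h6 hA0.le) hβ0.le
  nlinarith [h1, h2, h3, h4, h5, h7, h8, hA0, hβ, hβ0]

/-- **Nicolas 1983, Thm. 2 (a), large range (PROVED)**: under RH, Nicolas's inequality
`e^γ log log N < N/φ(N)` holds at the primorial `N = p#` for every (prime) `p ≥ 599² = 358801`
(`log N = θ(p)`, `N/φ(N) = ∏_{q ≤ p}(1 − 1/q)⁻¹`, so the inequality is `f(p) < 1`,
`Nicolas.nicolasF_natCast_eq`). [cite: Nicolas1983, Thm. 2 (a); Nicolas2012, Prop. 2.1; Broughan2017Arithmetic, §5.6 (pp. 135–137)] -/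
theorem nicolasInequality_primorial_of_RH_of_le (hS : Schoenfeld1976_theta) (hRH : RiemannHypothesis)
    {p : ℕ} (hle : 358801 ≤ p) : nicolasInequality (primorial p) := by
  have hpR : (358801 : ℝ) ≤ p := by exact_mod_cast hle
  have hlog := log_nicolasF_neg_of_RH hS hRH hpR
  have hf0 : 0 < nicolasF p := nicolasF_pos (by linarith)
  have hf1 : nicolasF p < 1 := (Real.log_neg_iff hf0).1 hlog
  rw [nicolasF_natCast_eq p] at hf1
  have hN0 : (0 : ℝ) < primorial p := by exact_mod_cast primorial_pos p
  have hφ0 : (0 : ℝ) < Nat.totient (primorial p) := by exact_mod_cast Nat.totient_pos.2 (primorial_pos p)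
  rw [nicolasInequality, lt_div_iff₀ hφ0]
  have := mul_lt_mul_of_pos_right hf1 hN0
  rw [one_mul] at this
  calc Real.exp Real.eulerMascheroniConstant * Real.log (Real.log (primorial p)) * Nat.totient (primorial p)
      = Real.exp Real.eulerMascheroniConstant * Real.log (Real.log (primorial p)) *
          ((Nat.totient (primorial p) : ℝ) / primorial p) * primorial p := by
        field_simp
    _ < primorial p := this

end NicolasUpper

end Literature.NumberTheory.LFunctions

end
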